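/-
Copyright (c) 2026. All rights reserved.
Released under Apache 2.0 license as described in the file LICENSE.
-/
import Mathlib
import Summits.Ventures.LatticeQCDFlow.Scaling.CosineBudget

/-!
# The tangent-line cosine budget on the whole circle, and the two mountain-pass values of the block insertion (item 108)

HONEST FRAMING: exact (Metropolis-corrected) sampling algorithms for lattice gauge theory;
figures of merit are autocorrelation/cost numbers at stated couplings and volumes; no
continuum-physics claim.

Venture `LatticeQCDFlow` (cell pub-lqcd), topic `Scaling`, FANOUT row 29 (theory2, gen-21), item 108.
NEW WORK (pure real analysis over Mathlib and `Scaling/CosineBudget`); nothing here is cited as a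
fact; no `def`.

`Scaling/CosineBudget` bounds `Σ (1 − cos xᵢ)` from below when `Σ |xᵢ| ≥ π` (tangent line of `cos` at
`c ≤ π/2` on `[0, π − c]` plus one large term).  The mountain-pass lower bound on the min–max height of
the block flux insertion (items 109a/b) needs the budget for SIGNED sums `Σ xᵢ` of angles anywhere on
`[−π, π]`, where a large term can have either sign.  The tool is the tangent line of `cos` at `c` on the
WHOLE interval `[−π, π]`:

* §1 `cos_le_tangent`: for `0 ≤ c ≤ π/4` and `−π ≤ x ≤ π`, `cos x ≤ cos c − sin c·(x − c)`.  On
  `[−π, π − c]` this is monotonicity; on `(π − c, π]` the gap is antitone in `x`, so it is its value at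
  `x = π`, `1 + cos c − (π − c) sin c`, which is antitone in `c` (`antitoneOn_tangentGap`) and still
  `≥ 0.04` at `c = π/4` (`tangentGap_pi_div_four_nonneg`; it changes sign at `c ≈ 0.81`, so `π/4` is
  nearly the largest admissible slope — the reason for the cap `π/4` everywhere below).
* §2 the budgets: `card·(1 − cos c) ≤ Σ (1 − cos xᵢ)` whenever `card·c ≤ |Σ xᵢ|`, `c ≤ π/4`
  (`card_mul_one_sub_cos_le_sum_of_abs_sum`); the two-point Jensen inequality
  (`twoPoint_one_sub_cos_ge`) and the two-tangent comparison at two different contact points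
  (`twoTangent_one_sub_cos_ge`).
* §3 numerics: `N(1 − cos(π/N)) + M(1 − cos(π/M)) ≤ 2(1 + cos(2π/N))` (`N ≥ 5`, `M ≥ 4`), and the
  `l = 2` cap inequality `5(1 − cos(π/5)) + M(1 − cos(π/M)) ≤ 5(1 − cos(π/4))` (`M ≥ 11`).
* §4 the two candidate values of the block height, `E⋆ = N(1 − cos(π/N)) + M(1 − cos(π/M))` (the
  half-way pass of item 107b) and `E∘ = (N+M)(1 − cos(2π/(N+M)))` (the uniform instanton), against the
  profile `Ψ(t) = N(1 − cos(min((2π − t)/N, π/4))) + M(1 − cos(t/M))`, `t ∈ [0, π]`, that items 109a/b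
  extract from an arbitrary charge-changing pair: `E∘ ≤ E⋆` always (strictly if `N ≠ M`,
  `uniformValue_lt_halfWayValue`), `E∘ ≤ Ψ(t)` always, and `E⋆ ≤ Ψ(t)` when `N ≤ M`
  (`halfWayValue_le_psi`) — the real inequalities behind the decision of THEORY-2.md §4 C9″b.
-/

noncomputable section

namespace Summit.Ventures.LatticeQCDFlow.Theory2.Trig

open Real Set

/-! ## §1 The tangent line of the cosine on the whole circle -/

/-- The derivative of the end-point gap `c ↦ 1 + cos c − (π − c) sin c` is `−(π − c) cos c`. [folklore] -/
theorem hasDerivAt_tangentGap (c : ℝ) :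
    HasDerivAt (fun c : ℝ => 1 + Real.cos c - (π - c) * Real.sin c) (-((π - c) * Real.cos c)) c := by
  have h := ((Real.hasDerivAt_cos c).const_add 1).sub
    (((hasDerivAt_id' c).const_sub π).mul (Real.hasDerivAt_sin c))
  have e : -Real.sin c - (-1 * Real.sin c + (π - c) * Real.cos c) = -((π - c) * Real.cos c) := by ring
  rw [e] at h
  exact h

/-- The end-point gap `1 + cos c − (π − c) sin c` is antitone on `[0, π/2]`. [folklore] -/
theorem antitoneOn_tangentGap :
    AntitoneOn (fun c : ℝ => 1 + Real.cos c - (π - c) * Real.sin c) (Icc 0 (π / 2)) := by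
  refine antitoneOn_of_deriv_nonpos (convex_Icc _ _) (by fun_prop : Continuous
      (fun c : ℝ => 1 + Real.cos c - (π - c) * Real.sin c)).continuousOn
    (fun c _ => (hasDerivAt_tangentGap c).differentiableAt.differentiableWithinAt) fun c hc => ?_
  rw [interior_Icc] at hc
  rw [(hasDerivAt_tangentGap c).deriv, neg_nonpos]
  exact mul_nonneg (by linarith [hc.2, Real.pi_pos])
    (Real.cos_nonneg_of_mem_Icc ⟨by linarith [hc.1, Real.pi_pos], hc.2.le⟩)

/-- `√2` to four places. [folklore] -/
theorem sqrt_two_bounds : (1.4142 : ℝ) < √2 ∧ √2 < (1.4143 : ℝ) := by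
  constructor
  · rw [Real.lt_sqrt (by norm_num)]; norm_num
  · rw [Real.sqrt_lt' (by norm_num)]; norm_num

/-- `√5` to three places. [folklore] -/
theorem sqrt_five_bounds : (2.236 : ℝ) < √5 ∧ √5 < (2.237 : ℝ) := by
  constructor
  · rw [Real.lt_sqrt (by norm_num)]; norm_num
  · rw [Real.sqrt_lt' (by norm_num)]; norm_num

/-- The end-point gap at the cap: `0 ≤ 1 + cos(π/4) − (3π/4) sin(π/4)` (`≈ 0.041`). [folklore] -/
theorem tangentGap_pi_div_four_nonneg :
    0 ≤ 1 + Real.cos (π / 4) - (π - π / 4) * Real.sin (π / 4) := by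
  rw [Real.cos_pi_div_four, Real.sin_pi_div_four]
  obtain ⟨hs1, hs2⟩ := sqrt_two_bounds
  nlinarith [mul_nonneg (sub_nonneg.2 hs1.le) (sub_nonneg.2 Real.pi_lt_d2.le), Real.pi_gt_d2]

/-- The end-point gap is non-negative up to the cap: `0 ≤ 1 + cos c − (π − c) sin c` for
`0 ≤ c ≤ π/4`. [folklore] -/
theorem tangentGap_nonneg {c : ℝ} (hc0 : 0 ≤ c) (hc : c ≤ π / 4) :
    0 ≤ 1 + Real.cos c - (π - c) * Real.sin c := by
  have h := antitoneOn_tangentGap ⟨hc0, by linarith [Real.pi_pos]⟩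
    ⟨by linarith [Real.pi_pos], by linarith [Real.pi_pos]⟩ hc
  exact tangentGap_pi_div_four_nonneg.trans h

/-- **THE TANGENT LINE OF THE COSINE ON THE WHOLE CIRCLE**: for `0 ≤ c ≤ π/4` and `−π ≤ x ≤ π`,
`cos x ≤ cos c − sin c·(x − c)`. [folklore] -/
theorem cos_le_tangent {c x : ℝ} (hc0 : 0 ≤ c) (hc : c ≤ π / 4) (hx1 : -π ≤ x) (hx2 : x ≤ π) :
    Real.cos x ≤ Real.cos c - Real.sin c * (x - c) := by
  have hc2 : c ≤ π / 2 := hc.trans (by linarith [Real.pi_pos])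
  have hsin : 0 ≤ Real.sin c := Real.sin_nonneg_of_nonneg_of_le_pi hc0 (by linarith [Real.pi_pos])
  have hcos : 0 ≤ Real.cos c := Real.cos_nonneg_of_mem_Icc ⟨by linarith [Real.pi_pos], hc2⟩
  rcases lt_or_ge x 0 with hx0 | hx0
  · rcases le_or_gt (-x) (π - c) with hy | hy
    · have h := cos_le_cos_sub_sin_mul hc0 hc2 (by linarith) hy
      rw [Real.cos_neg] at h
      have : Real.sin c * (2 * x) ≤ 0 := mul_nonpos_of_nonneg_of_nonpos hsin (by linarith)
      linarith
    · have h1 : Real.cos (-x) ≤ Real.cos (π - c) :=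
        Real.cos_le_cos_of_nonneg_of_le_pi (by linarith) (by linarith) hy.le
      rw [Real.cos_neg, Real.cos_pi_sub] at h1
      have : Real.sin c * (x - c) ≤ 0 := mul_nonpos_of_nonneg_of_nonpos hsin (by linarith)
      linarith
  · rcases le_or_gt x (π - c) with hxc | hxc
    · exact cos_le_cos_sub_sin_mul hc0 hc2 hx0 hxc
    · have hd : ∀ y, HasDerivAt (fun y : ℝ => Real.cos c - Real.sin c * (y - c) - Real.cos y)
          (Real.sin y - Real.sin c) y := by
        intro y
        have h2 : HasDerivAt (fun y : ℝ => Real.cos c - Real.sin c * (y - c) - Real.cos y)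
            (0 - Real.sin c * 1 - -Real.sin y) y :=
          ((hasDerivAt_const y (Real.cos c)).sub
            (((hasDerivAt_id' y).sub_const c).const_mul (Real.sin c))).sub (Real.hasDerivAt_cos y)
        have e : (0 : ℝ) - Real.sin c * 1 - -Real.sin y = Real.sin y - Real.sin c := by ring
        rw [e] at h2
        exact h2
      have hanti : AntitoneOn (fun y : ℝ => Real.cos c - Real.sin c * (y - c) - Real.cos y)
          (Icc (π - c) π) := by
        refine antitoneOn_of_deriv_nonpos (convex_Icc _ _) (by fun_prop : Continuous
            (fun y : ℝ => Real.cos c - Real.sin c * (y - c) - Real.cos y)).continuousOn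
          (fun y _ => (hd y).differentiableAt.differentiableWithinAt) fun y hy => ?_
        rw [interior_Icc] at hy
        rw [(hd y).deriv, sub_nonpos, ← Real.sin_pi_sub y]
        exact Real.sin_le_sin_of_le_of_le_pi_div_two (by linarith [hy.2]) hc2 (by linarith [hy.1])
      have h := hanti ⟨hxc.le, hx2⟩ ⟨by linarith, le_rfl⟩ hx2
      simp only [Real.cos_pi] at h
      have hgap := tangentGap_nonneg hc0 hc
      linarith

/-! ## §2 Budgets for signed sums of angles -/

/-- **Signed cosine budget**: if `−π ≤ xᵢ ≤ π`, `0 ≤ c ≤ π/4` and `card·c ≤ Σ xᵢ` then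
`card·(1 − cos c) ≤ Σ (1 − cos xᵢ)` (sum of the tangent lines at `c`). [folklore] -/
theorem card_mul_one_sub_cos_le_sum_of_le_sum {ι : Type*} (s : Finset ι) (x : ι → ℝ) {c : ℝ}
    (hc0 : 0 ≤ c) (hc : c ≤ π / 4) (hx : ∀ i ∈ s, -π ≤ x i ∧ x i ≤ π)
    (hsum : (s.card : ℝ) * c ≤ ∑ i ∈ s, x i) :
    (s.card : ℝ) * (1 - Real.cos c) ≤ ∑ i ∈ s, (1 - Real.cos (x i)) := by
  have hsin : 0 ≤ Real.sin c := Real.sin_nonneg_of_nonneg_of_le_pi hc0 (by linarith [Real.pi_pos])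
  calc (s.card : ℝ) * (1 - Real.cos c)
      ≤ (s.card : ℝ) * (1 - Real.cos c) + Real.sin c * (∑ i ∈ s, x i - (s.card : ℝ) * c) :=
        le_add_of_nonneg_right (mul_nonneg hsin (sub_nonneg.2 hsum))
    _ = ∑ i ∈ s, ((1 - Real.cos c) + Real.sin c * (x i - c)) := by
        rw [Finset.sum_add_distrib, Finset.sum_const, nsmul_eq_mul, ← Finset.mul_sum,
          Finset.sum_sub_distrib, Finset.sum_const, nsmul_eq_mul]
    _ ≤ ∑ i ∈ s, (1 - Real.cos (x i)) :=
        Finset.sum_le_sum fun i hi => by linarith [cos_le_tangent hc0 hc (hx i hi).1 (hx i hi).2]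

/-- **Signed cosine budget, absolute form**: if `−π ≤ xᵢ ≤ π`, `0 ≤ c ≤ π/4` and `card·c ≤ |Σ xᵢ|`
then `card·(1 − cos c) ≤ Σ (1 − cos xᵢ)`. [folklore] -/
theorem card_mul_one_sub_cos_le_sum_of_abs_sum {ι : Type*} (s : Finset ι) (x : ι → ℝ) {c : ℝ}
    (hc0 : 0 ≤ c) (hc : c ≤ π / 4) (hx : ∀ i ∈ s, -π ≤ x i ∧ x i ≤ π)
    (hsum : (s.card : ℝ) * c ≤ |∑ i ∈ s, x i|) :
    (s.card : ℝ) * (1 - Real.cos c) ≤ ∑ i ∈ s, (1 - Real.cos (x i)) := by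
  rcases le_or_gt 0 (∑ i ∈ s, x i) with h0 | h0
  · rw [abs_of_nonneg h0] at hsum
    exact card_mul_one_sub_cos_le_sum_of_le_sum s x hc0 hc hx hsum
  · rw [abs_of_neg h0, ← Finset.sum_neg_distrib] at hsum
    have h := card_mul_one_sub_cos_le_sum_of_le_sum s (fun i => -x i) hc0 hc
      (fun i hi => ⟨by linarith [(hx i hi).2], by linarith [(hx i hi).1]⟩) hsum
    simpa only [Real.cos_neg] using h

/-- **Two-point Jensen inequality** for `1 − cos` below the cap: for weights `p, q ≥ 0`, angles
`a, b ∈ [−π, π]` and `0 ≤ c ≤ π/4` with `(p + q)c ≤ pa + qb`,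
`(p + q)(1 − cos c) ≤ p(1 − cos a) + q(1 − cos b)`. [folklore] -/
theorem twoPoint_one_sub_cos_ge {p q a b c : ℝ} (hp : 0 ≤ p) (hq : 0 ≤ q) (hc0 : 0 ≤ c)
    (hc : c ≤ π / 4) (ha : -π ≤ a ∧ a ≤ π) (hb : -π ≤ b ∧ b ≤ π)
    (hmean : (p + q) * c ≤ p * a + q * b) :
    (p + q) * (1 - Real.cos c) ≤ p * (1 - Real.cos a) + q * (1 - Real.cos b) := by
  have hsin : 0 ≤ Real.sin c := Real.sin_nonneg_of_nonneg_of_le_pi hc0 (by linarith [Real.pi_pos])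
  have h1 := mul_le_mul_of_nonneg_left (cos_le_tangent hc0 hc ha.1 ha.2) hp
  have h2 := mul_le_mul_of_nonneg_left (cos_le_tangent hc0 hc hb.1 hb.2) hq
  have h3 : 0 ≤ Real.sin c * (p * a + q * b - (p + q) * c) := mul_nonneg hsin (sub_nonneg.2 hmean)
  nlinarith [h1, h2, h3]

/-- **Two-tangent comparison**: for weights `p, q ≥ 0`, contact points `0 ≤ c₂ ≤ c₁ ≤ π/4` and angles
`a, b ∈ [−π, π]` with `pa + qb = pc₁ + qc₂` and `c₁ ≤ a` (the weight moved from the `q`-group to the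
`p`-group), `p(1 − cos c₁) + q(1 − cos c₂) ≤ p(1 − cos a) + q(1 − cos b)`. [folklore] -/
theorem twoTangent_one_sub_cos_ge {p q a b c₁ c₂ : ℝ} (hp : 0 ≤ p) (hq : 0 ≤ q) (hc₂ : 0 ≤ c₂)
    (h21 : c₂ ≤ c₁) (hc₁ : c₁ ≤ π / 4) (ha : -π ≤ a ∧ a ≤ π) (hb : -π ≤ b ∧ b ≤ π)
    (hsum : p * a + q * b = p * c₁ + q * c₂) (hca : c₁ ≤ a) :
    p * (1 - Real.cos c₁) + q * (1 - Real.cos c₂) ≤ p * (1 - Real.cos a) + q * (1 - Real.cos b) := by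
  have h1 := mul_le_mul_of_nonneg_left (cos_le_tangent (hc₂.trans h21) hc₁ ha.1 ha.2) hp
  have h2 := mul_le_mul_of_nonneg_left (cos_le_tangent hc₂ (h21.trans hc₁) hb.1 hb.2) hq
  have hs : Real.sin c₂ ≤ Real.sin c₁ :=
    Real.sin_le_sin_of_le_of_le_pi_div_two (by linarith [Real.pi_pos]) (by linarith [Real.pi_pos]) h21
  have h4 : 0 ≤ p * (a - c₁) * (Real.sin c₁ - Real.sin c₂) :=
    mul_nonneg (mul_nonneg hp (sub_nonneg.2 hca)) (sub_nonneg.2 hs)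
  have h5 : q * (b - c₂) = -(p * (a - c₁)) := by linarith
  have h6 : Real.sin c₂ * (q * (b - c₂)) = Real.sin c₂ * (-(p * (a - c₁))) := by rw [h5]
  nlinarith [h1, h2, h4, h6]

/-! ## §3 Numerical comparisons -/

/-- `n(1 − cos(π/n)) ≤ π²/(2n)` (`0 < n`). [folklore] -/
theorem mul_one_sub_cos_pi_div_le {n : ℝ} (hn : 0 < n) :
    n * (1 - Real.cos (π / n)) ≤ π ^ 2 / (2 * n) := by
  have h := Real.one_sub_sq_div_two_le_cos (x := π / n)
  have e : n * ((π / n) ^ 2 / 2) = π ^ 2 / (2 * n) := by field_simp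
  rw [← e]
  exact mul_le_mul_of_nonneg_left (by linarith) hn.le

-- LANDING NOTE (lean-1 GEN-6, custody, LEAD LINE 113 RT-30 (117)(d)): theory2's
-- `halfWayValue_le_two_wraps` (N(1 − cos(π/N)) + M(1 − cos(π/M)) ≤ 2(1 + cos(2π/N)), N ≥ 5, M ≥ 4)
-- is deleted here: the gate's `dedup.landed` identified it with the tree's
-- `Summit.Ventures.LatticeQCDFlow.Theory2.Lattice.Flux.sharpValue_le_jumpPrice_real`
-- (`Scaling/FluxInsertionMountainPass.lean`, p320933); use that declaration instead.

/-- **The `l = 2` cap inequality**: `5(1 − cos(π/5)) + M(1 − cos(π/M)) ≤ 5(1 − cos(π/4))` for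
`M ≥ 11`. [folklore] -/
theorem halfWayValue_five_le_cap {M : ℝ} (hM : 11 ≤ M) :
    5 * (1 - Real.cos (π / 5)) + M * (1 - Real.cos (π / M)) ≤ 5 * (1 - Real.cos (π / 4)) := by
  have hMp : 0 < M := by linarith
  have h2 := mul_one_sub_cos_pi_div_le hMp
  have h5 : π ^ 2 / (2 * M) ≤ π ^ 2 / 22 :=
    div_le_div_of_nonneg_left (sq_nonneg π) (by norm_num) (by linarith)
  have hπ2 : π ^ 2 < 9.9225 := by nlinarith [Real.pi_lt_d2, Real.pi_pos]
  rw [Real.cos_pi_div_five, Real.cos_pi_div_four]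
  obtain ⟨hs1, hs2⟩ := sqrt_two_bounds
  obtain ⟨hf1, hf2⟩ := sqrt_five_bounds
  nlinarith [h2, h5, hπ2]

/-! ## §4 The two candidate values against the extracted profile -/

/-- **The uniform instanton is never dearer than the half-way pass**:
`(N+M)(1 − cos(2π/(N+M))) ≤ N(1 − cos(π/N)) + M(1 − cos(π/M))` (`N ≥ 5`, `M ≥ 4`; Jensen). [folklore] -/
theorem uniformValue_le_halfWayValue {N M : ℝ} (hN : 5 ≤ N) (hM : 4 ≤ M) :
    (N + M) * (1 - Real.cos (2 * π / (N + M))) ≤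
      N * (1 - Real.cos (π / N)) + M * (1 - Real.cos (π / M)) := by
  have hNp : 0 < N := by linarith
  have hMp : 0 < M := by linarith
  have hπ := Real.pi_pos
  refine twoPoint_one_sub_cos_ge hNp.le hMp.le (by positivity) ?_ ⟨?_, ?_⟩ ⟨?_, ?_⟩ (le_of_eq ?_)
  · rw [div_le_div_iff₀ (by positivity) (by norm_num)]; nlinarith
  · exact le_trans (by linarith) (div_nonneg hπ.le hNp.le)
  · rw [div_le_iff₀ hNp]; nlinarith
  · exact le_trans (by linarith) (div_nonneg hπ.le hMp.le)
  · rw [div_le_iff₀ hMp]; nlinarith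
  · field_simp; ring

/-- **Strictly cheaper off the diagonal**: for `N ≠ M`,
`(N+M)(1 − cos(2π/(N+M))) < N(1 − cos(π/N)) + M(1 − cos(π/M))` (strict concavity of `cos` on
`[−π/2, π/2]`). [folklore] -/
theorem uniformValue_lt_halfWayValue {N M : ℝ} (hN : 5 ≤ N) (hM : 4 ≤ M) (hne : N ≠ M) :
    (N + M) * (1 - Real.cos (2 * π / (N + M))) <
      N * (1 - Real.cos (π / N)) + M * (1 - Real.cos (π / M)) := by
  have hπ := Real.pi_pos
  have hNp : 0 < N := by linarith
  have hMp : 0 < M := by linarith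
  have hS : 0 < N + M := by linarith
  have ha : π / N ∈ Icc (-(π / 2)) (π / 2) :=
    ⟨le_trans (by linarith) (div_nonneg hπ.le hNp.le), by rw [div_le_div_iff₀ hNp two_pos]; nlinarith⟩
  have hb : π / M ∈ Icc (-(π / 2)) (π / 2) :=
    ⟨le_trans (by linarith) (div_nonneg hπ.le hMp.le), by rw [div_le_div_iff₀ hMp two_pos]; nlinarith⟩
  have hab : π / N ≠ π / M := by
    intro h
    have h' := (div_eq_div_iff hNp.ne' hMp.ne').mp h
    exact hne (mul_left_cancel₀ hπ.ne' h'.symm)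
  have h := strictConcaveOn_cos_Icc.2 ha hb hab (div_pos hNp hS) (div_pos hMp hS)
    (by rw [← add_div, div_self hS.ne'])
  simp only [smul_eq_mul] at h
  have e : N / (N + M) * (π / N) + M / (N + M) * (π / M) = 2 * π / (N + M) := by
    field_simp
    ring
  rw [e] at h
  have h2 := mul_lt_mul_of_pos_left h hS
  have key : (N + M) * (N / (N + M) * Real.cos (π / N) + M / (N + M) * Real.cos (π / M)) =
      N * Real.cos (π / N) + M * Real.cos (π / M) := by
    field_simp
  rw [key] at h2
  linarith

/-- **The uniform instanton value is below the profile**: for `t ∈ [0, π]`,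
`(N+M)(1 − cos(2π/(N+M))) ≤ N(1 − cos(min((2π − t)/N, π/4))) + M(1 − cos(t/M))`
(`N = 5` or `N ≥ 8`, `M ≥ 4`, and `M ≥ 11` if `N = 5`). [folklore] -/
theorem uniformValue_le_psi {N M t : ℝ} (hN : N = 5 ∨ 8 ≤ N) (hM : 4 ≤ M) (hNM : N = 5 → 11 ≤ M)
    (ht0 : 0 ≤ t) (ht : t ≤ π) :
    (N + M) * (1 - Real.cos (2 * π / (N + M))) ≤
      N * (1 - Real.cos (min ((2 * π - t) / N) (π / 4))) + M * (1 - Real.cos (t / M)) := by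
  have hπ := Real.pi_pos
  have hN5 : 5 ≤ N := by rcases hN with h | h <;> linarith
  have hNp : 0 < N := by linarith
  have hMp : 0 < M := by linarith
  rcases le_or_gt ((2 * π - t) / N) (π / 4) with hcap | hcap
  · rw [min_eq_left hcap]
    refine twoPoint_one_sub_cos_ge hNp.le hMp.le (by positivity) ?_ ⟨?_, ?_⟩ ⟨?_, ?_⟩ (le_of_eq ?_)
    · rw [div_le_div_iff₀ (by positivity) (by norm_num)]; nlinarith
    · exact le_trans (by linarith) (div_nonneg (by linarith) hNp.le)
    · exact hcap.trans (by linarith)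
    · exact le_trans (by linarith) (div_nonneg ht0 hMp.le)
    · rw [div_le_iff₀ hMp]; nlinarith
    · field_simp; ring
  · -- the cap is active: then `N < 8`, so `N = 5` and `M ≥ 11`
    have hN8 : N < 8 := by
      by_contra h8
      push Not at h8
      have : (2 * π - t) / N ≤ π / 4 := by
        rw [div_le_div_iff₀ hNp (by norm_num)]; nlinarith
      linarith
    have h5 : N = 5 := by rcases hN with h | h; exact h; linarith
    have hM11 := hNM h5
    rw [min_eq_right hcap.le, h5]
    have hA := uniformValue_le_halfWayValue hN5 hM
    rw [h5] at hA
    have hB := halfWayValue_five_le_cap hM11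
    have hC : 0 ≤ M * (1 - Real.cos (t / M)) := mul_nonneg hMp.le (sub_nonneg.2 (Real.cos_le_one _))
    linarith

/-- **The half-way value is below the profile when the block is the minority** (`N ≤ M`): for
`t ∈ [0, π]`, `N(1 − cos(π/N)) + M(1 − cos(π/M)) ≤ N(1 − cos(min((2π − t)/N, π/4))) + M(1 − cos(t/M))`
(`N = 5` or `N ≥ 8`, `M ≥ 4`, `M ≥ 11` if `N = 5`). [folklore] -/
theorem halfWayValue_le_psi {N M t : ℝ} (hN : N = 5 ∨ 8 ≤ N) (hM : 4 ≤ M) (hNM : N = 5 → 11 ≤ M)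
    (hle : N ≤ M) (ht0 : 0 ≤ t) (ht : t ≤ π) :
    N * (1 - Real.cos (π / N)) + M * (1 - Real.cos (π / M)) ≤
      N * (1 - Real.cos (min ((2 * π - t) / N) (π / 4))) + M * (1 - Real.cos (t / M)) := by
  have hπ := Real.pi_pos
  have hN5 : 5 ≤ N := by rcases hN with h | h <;> linarith
  have hNp : 0 < N := by linarith
  have hMp : 0 < M := by linarith
  rcases le_or_gt ((2 * π - t) / N) (π / 4) with hcap | hcap
  · rw [min_eq_left hcap]
    refine twoTangent_one_sub_cos_ge hNp.le hMp.le (div_nonneg hπ.le hMp.le) ?_ ?_ ⟨?_, ?_⟩ ⟨?_, ?_⟩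
      ?_ ?_
    · exact div_le_div_of_nonneg_left hπ.le hNp hle
    · rw [div_le_div_iff₀ hNp (by norm_num)]; nlinarith
    · exact le_trans (by linarith) (div_nonneg (by linarith) hNp.le)
    · exact hcap.trans (by linarith)
    · exact le_trans (by linarith) (div_nonneg ht0 hMp.le)
    · rw [div_le_iff₀ hMp]; nlinarith
    · field_simp; ring
    · rw [div_le_div_iff_of_pos_right hNp]; linarith
  · have hN8 : N < 8 := by
      by_contra h8
      push Not at h8
      have : (2 * π - t) / N ≤ π / 4 := by
        rw [div_le_div_iff₀ hNp (by norm_num)]; nlinarith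
      linarith
    have h5 : N = 5 := by rcases hN with h | h; exact h; linarith
    have hM11 := hNM h5
    rw [min_eq_right hcap.le, h5]
    have hB := halfWayValue_five_le_cap hM11
    have hC : 0 ≤ M * (1 - Real.cos (t / M)) := mul_nonneg hMp.le (sub_nonneg.2 (Real.cos_le_one _))
    linarith

end Summit.Ventures.LatticeQCDFlow.Theory2.Trig

end
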